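import Mathlib
import HarnessLib
import Summits.HubbardSuperconductivity.HubbardSuperconductivity.Theorems.KLProgrammeKLRegimeCountertermJacksonRemainderStructuredLocal
import Summits.HubbardSuperconductivity.HubbardSuperconductivity.Theorems.KLProgrammeKLRegimeCountertermJacksonRemainderFlowMoments

/-!
# Route `KLProgramme`, crux K3 — gen-8 ENGINE-FLOW child (stmt-HubbardSuperconductivity-20437 `KLRegimeEngineV17F2`), stub (C)
# `stub_twoLeg_curvature`: the (C1) JACKSON-REMAINDER DOOR v2, part 4 — the bundle's angular factor is regular at almost every displacement,
# and the whole-square flow instance with NO smoothness hypothesis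

Seat hubbard-kl-k3c3-p1 (g6).  The bundle's angular factor `A = (f − mean f)∘polarAngle∘centredRep∘ofLp` fails to be smooth only on the cell-boundary
lines (where `centredRep` jumps) and at the lattice points (where `polarAngle` is singular).  Seen from a curve point `x = γ θ`, the displacements `w`
with `x − v_w` on that set form countably many axis-parallel lines of the smoothing square — a NULL set.  Hence the a.e. form of part 2b applies to the
bundle's own factor with `E_μ f = mean f + χ·A` holding by `rfl`:
* §1 `contDiffAt_angularFactor_of_offGrid` (off the lines and lattice points `A` is `C^N` at the point: locally `centredRep` is a translation,
  then k3c3-p1 g2's `contDiffAt_comp_polarAngle_ofLp`);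
* §2 `ae_jmeas_offGrid` (for every `x`, a.e. `w` has `x − v_w` off the grid), `ae_jmeas_contDiffAt_angularFactor_comp_curve_sub`;
* §2b `abs_iteratedDeriv_jhigh1_comp_curve_le_mixedMoments_ae_of_integrable` (integrable instead of continuous majorants: step-function enclosures);
* §3 **`flowPiece_reading_remainder_jets_mixedMoments_ae`** — the (C1) object's jets `≤ Σ_{i≤k} C(k,i)·Mx i + Tm` from a.e.-in-`w` majorants over the
  whole square and their mixed moments, nothing else (evidence #42 `C1-CUTOFF-DEFECT-MOMENTS.md`: the certificate's targets).
Pure real analysis + unfolding; no definitions; nothing here asserts superconductivity.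
-/

noncomputable section

namespace Summit.HubbardSuperconductivity.HubbardSuperconductivity.Theorems.KLRegimeSplit

set_option linter.dupNamespace false -- summit = problem name (single-conjunct summit), D-0017

open Real MeasureTheory Filter Metric Function
open scoped Topology ContDiff
open Literature.Analysis.Fourier.TrigApprox Literature.MathematicalPhysics.QuantumLattice

/-! ## §1 The angular factor is smooth off the grid -/

section OffGrid

/-- **Off the cell-boundary lines and the lattice points, `q ↦ f(polarAngle(centredRep q))` is `C^N` at `q`** (for `2π`-periodic `C^N` `f`). -/
theorem contDiffAt_angularFactor_of_offGrid {f : ℝ → ℝ} {N : ℕ∞} (hf : ContDiff ℝ N f) (hper : Function.Periodic f (2 * Real.pi))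
    {q : EuclideanSpace ℝ (Fin 2)}
    (hne : ∀ i : Fin 2, toIocMod Real.two_pi_pos (-Real.pi) (WithLp.ofLp q i) ≠ -Real.pi + 2 * Real.pi)
    (hq0 : (WithLp.toLp 2 fun i => toIocMod Real.two_pi_pos (-Real.pi) (WithLp.ofLp q i) : EuclideanSpace ℝ (Fin 2)) ≠ 0) :
    ContDiffAt ℝ N (fun q : EuclideanSpace ℝ (Fin 2) => f (polarAngle (centredRep (WithLp.ofLp q)))) q := by
  set z : Fin 2 → ℤ := fun i => toIocDiv Real.two_pi_pos (-Real.pi) (WithLp.ofLp q i) with hz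
  set c : EuclideanSpace ℝ (Fin 2) := WithLp.toLp 2 fun i => (z i : ℝ) * (2 * Real.pi) with hc
  have hev1 : ∀ i : Fin 2, ∀ᶠ q' : EuclideanSpace ℝ (Fin 2) in 𝓝 q,
      toIocMod Real.two_pi_pos (-Real.pi) (WithLp.ofLp q' i) = WithLp.ofLp q' i - (z i : ℝ) * (2 * Real.pi) := by
    intro i
    have hcont : ContinuousAt (fun q' : EuclideanSpace ℝ (Fin 2) => WithLp.ofLp q' i) q :=
      ((continuous_apply i).comp (PiLp.continuous_ofLp 2 _)).continuousAt
    have h2 := hcont.eventually (eventually_toIocMod_eq_sub Real.two_pi_pos (-Real.pi) (hne i))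
    filter_upwards [h2] with q' hq'
    rw [hq', zsmul_eq_mul]
  have hevall : ∀ᶠ q' : EuclideanSpace ℝ (Fin 2) in 𝓝 q, ∀ i : Fin 2,
      toIocMod Real.two_pi_pos (-Real.pi) (WithLp.ofLp q' i) = WithLp.ofLp q' i - (z i : ℝ) * (2 * Real.pi) :=
    Filter.eventually_all.mpr hev1
  -- locally, centring is the translation by `c`
  have hev : (fun q' : EuclideanSpace ℝ (Fin 2) => f (polarAngle (centredRep (WithLp.ofLp q')))) =ᶠ[𝓝 q]
      fun q' => (fun p : EuclideanSpace ℝ (Fin 2) => f (polarAngle (WithLp.ofLp p))) (q' - c) := by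
    filter_upwards [hevall] with q' hq'
    have hcen : centredRep (WithLp.ofLp q') = WithLp.ofLp (q' - c) := by
      funext i
      show toIocMod Real.two_pi_pos (-π) (WithLp.ofLp q' i) = _
      rw [hq' i, WithLp.ofLp_sub, Pi.sub_apply, hc, WithLp.ofLp_toLp]
    simp only [hcen]
  have hq' := hevall.self_of_nhds
  have hqc : q - c ≠ 0 := by
    intro h0
    apply hq0
    have : (fun i => toIocMod Real.two_pi_pos (-Real.pi) (WithLp.ofLp q i)) = WithLp.ofLp (q - c) := by
      funext i; rw [hq' i, WithLp.ofLp_sub, Pi.sub_apply, hc, WithLp.ofLp_toLp]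
    rw [this, h0, WithLp.ofLp_zero]; rfl
  have hS : ContDiffAt ℝ N (fun p : EuclideanSpace ℝ (Fin 2) => f (polarAngle (WithLp.ofLp p))) (q - c) :=
    contDiffAt_comp_polarAngle_ofLp hf hper hqc
  have hshift : ContDiffAt ℝ N (fun q' : EuclideanSpace ℝ (Fin 2) => (fun p : EuclideanSpace ℝ (Fin 2) => f (polarAngle (WithLp.ofLp p))) (q' - c)) q :=
    ContDiffAt.comp (f := fun q' : EuclideanSpace ℝ (Fin 2) => q' - c) q hS (contDiff_id.sub contDiff_const).contDiffAt
  exact hshift.congr_of_eventuallyEq hev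

/-- Along a `C⁴` curve displaced by `v`: if `γ θ − v` is off the grid then `ϑ ↦ f(polarAngle(centredRep(γϑ − v))) − m` is `C⁴` AT `θ`. -/
theorem contDiffAt_angularFactor_comp_curve_sub {f : ℝ → ℝ} (hf : ContDiff ℝ 4 f) (hper : Function.Periodic f (2 * Real.pi)) (m : ℝ)
    {γ : ℝ → EuclideanSpace ℝ (Fin 2)} (hγ : ContDiff ℝ 4 γ) (v : EuclideanSpace ℝ (Fin 2)) {θ : ℝ}
    (hne : ∀ i : Fin 2, toIocMod Real.two_pi_pos (-Real.pi) (WithLp.ofLp (γ θ - v) i) ≠ -Real.pi + 2 * Real.pi)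
    (hq0 : (WithLp.toLp 2 fun i => toIocMod Real.two_pi_pos (-Real.pi) (WithLp.ofLp (γ θ - v) i) : EuclideanSpace ℝ (Fin 2)) ≠ 0) :
    ContDiffAt ℝ 4 (fun ϑ : ℝ => f (polarAngle (centredRep (WithLp.ofLp (γ ϑ - v)))) - m) θ := by
  have hA := contDiffAt_angularFactor_of_offGrid (N := 4) hf hper hne hq0
  have hcomp : ContDiffAt ℝ 4 (fun ϑ : ℝ => (fun q : EuclideanSpace ℝ (Fin 2) => f (polarAngle (centredRep (WithLp.ofLp q)))) (γ ϑ - v)) θ :=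
    ContDiffAt.comp (f := fun ϑ : ℝ => γ ϑ - v) θ hA (hγ.sub contDiff_const).contDiffAt
  exact hcomp.sub contDiffAt_const

end OffGrid

/-! ## §2 Almost every displacement is off the grid -/

section AE

/-- The coordinates of a displaced point: `(x − v_w)₀ = x₀ − s`, `(x − v_w)₁ = x₁ − t`. -/
theorem ofLp_sub_jshift_apply (x : EuclideanSpace ℝ (Fin 2)) (w : ℝ × ℝ) :
    WithLp.ofLp (x - jshift w) 0 = WithLp.ofLp x 0 - w.1 ∧ WithLp.ofLp (x - jshift w) 1 = WithLp.ofLp x 1 - w.2 := by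
  constructor <;> simp [jshift]

/-- **For every base point `x`, almost every displacement of the smoothing square puts `x − v_w` OFF the grid** (not on a cell-boundary line,
centred representative not the origin): the exceptional `w` lie on countably many axis-parallel lines. -/
theorem ae_jmeas_offGrid (x : EuclideanSpace ℝ (Fin 2)) :
    ∀ᵐ w ∂jmeas, (∀ i : Fin 2, toIocMod Real.two_pi_pos (-Real.pi) (WithLp.ofLp (x - jshift w) i) ≠ -Real.pi + 2 * Real.pi) ∧
      (WithLp.toLp 2 fun i => toIocMod Real.two_pi_pos (-Real.pi) (WithLp.ofLp (x - jshift w) i) : EuclideanSpace ℝ (Fin 2)) ≠ 0 := by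
  -- the exceptional set is contained in a countable union of axis-parallel lines
  set B : Set (ℝ × ℝ) := (⋃ z : ℤ, {w : ℝ × ℝ | w.1 = WithLp.ofLp x 0 - (Real.pi + z • (2 * Real.pi))}) ∪
    ((⋃ z : ℤ, {w : ℝ × ℝ | w.2 = WithLp.ofLp x 1 - (Real.pi + z • (2 * Real.pi))}) ∪
      ⋃ z : ℤ, {w : ℝ × ℝ | w.1 = WithLp.ofLp x 0 - (0 + z • (2 * Real.pi))}) with hB
  -- axis-parallel lines are Lebesgue-null (`{a} ×ˢ univ`, `univ ×ˢ {a}`; cf. `Literature.Analysis.PDE.ConservationLaw.volume_setOf_fst_eq`)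
  have hl1 : ∀ a : ℝ, volume {w : ℝ × ℝ | w.1 = a} = 0 := fun a => by
    have e : {w : ℝ × ℝ | w.1 = a} = ({a} : Set ℝ) ×ˢ (Set.univ : Set ℝ) := by ext w; simp
    rw [e, show (volume : Measure (ℝ × ℝ)) = (volume : Measure ℝ).prod volume from rfl, Measure.prod_prod, Real.volume_singleton, zero_mul]
  have hl2 : ∀ a : ℝ, volume {w : ℝ × ℝ | w.2 = a} = 0 := fun a => by
    have e : {w : ℝ × ℝ | w.2 = a} = (Set.univ : Set ℝ) ×ˢ ({a} : Set ℝ) := by ext w; simp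
    rw [e, show (volume : Measure (ℝ × ℝ)) = (volume : Measure ℝ).prod volume from rfl, Measure.prod_prod, Real.volume_singleton, mul_zero]
  have hBnull : volume B = 0 := by
    refine measure_union_null (measure_iUnion_null fun z => hl1 _)
      (measure_union_null (measure_iUnion_null fun z => hl2 _) (measure_iUnion_null fun z => hl1 _))
  have hsub : {w : ℝ × ℝ | ¬((∀ i : Fin 2, toIocMod Real.two_pi_pos (-Real.pi) (WithLp.ofLp (x - jshift w) i) ≠ -Real.pi + 2 * Real.pi) ∧
      (WithLp.toLp 2 fun i => toIocMod Real.two_pi_pos (-Real.pi) (WithLp.ofLp (x - jshift w) i) : EuclideanSpace ℝ (Fin 2)) ≠ 0)} ⊆ B := by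
    intro w hw
    simp only [Set.mem_setOf_eq, not_and_or, not_forall, not_not] at hw
    obtain ⟨h0, h1⟩ := ofLp_sub_jshift_apply x w
    have hππ : -Real.pi + 2 * Real.pi = Real.pi := by ring
    rcases hw with ⟨i, hi⟩ | h
    · -- on a cell-boundary line in coordinate `i`
      rw [hππ] at hi
      obtain ⟨-, z, hz⟩ := (toIocMod_eq_iff Real.two_pi_pos).1 hi
      fin_cases i
      · left
        simp only [Set.mem_iUnion, Set.mem_setOf_eq]
        refine ⟨z, ?_⟩
        have : WithLp.ofLp (x - jshift w) 0 = Real.pi + z • (2 * Real.pi) := hz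
        rw [h0] at this; linarith
      · right; left
        simp only [Set.mem_iUnion, Set.mem_setOf_eq]
        refine ⟨z, ?_⟩
        have : WithLp.ofLp (x - jshift w) 1 = Real.pi + z • (2 * Real.pi) := hz
        rw [h1] at this; linarith
    · -- centred representative is the origin ⇒ coordinate 0 is a lattice value
      have h00 : toIocMod Real.two_pi_pos (-Real.pi) (WithLp.ofLp (x - jshift w) 0) = 0 := by
        have := congrArg (fun v : EuclideanSpace ℝ (Fin 2) => WithLp.ofLp v 0) h
        simpa using this
      obtain ⟨-, z, hz⟩ := (toIocMod_eq_iff Real.two_pi_pos).1 h00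
      right; right
      simp only [Set.mem_iUnion, Set.mem_setOf_eq]
      refine ⟨z, ?_⟩
      have : WithLp.ofLp (x - jshift w) 0 = 0 + z • (2 * Real.pi) := hz
      rw [h0] at this; linarith
  have hvol : ∀ᵐ w ∂(volume : Measure (ℝ × ℝ)),
      (∀ i : Fin 2, toIocMod Real.two_pi_pos (-Real.pi) (WithLp.ofLp (x - jshift w) i) ≠ -Real.pi + 2 * Real.pi) ∧
        (WithLp.toLp 2 fun i => toIocMod Real.two_pi_pos (-Real.pi) (WithLp.ofLp (x - jshift w) i) : EuclideanSpace ℝ (Fin 2)) ≠ 0 := by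
    rw [ae_iff]
    exact measure_mono_null hsub hBnull
  rw [jmeas_eq_restrict]
  exact ae_restrict_of_ae hvol

/-- **Almost every displaced curve carries a `C⁴` angular factor at `θ`.** -/
theorem ae_jmeas_contDiffAt_angularFactor_comp_curve_sub {f : ℝ → ℝ} (hf : ContDiff ℝ 4 f) (hper : Function.Periodic f (2 * Real.pi))
    (m : ℝ) {γ : ℝ → EuclideanSpace ℝ (Fin 2)} (hγ : ContDiff ℝ 4 γ) (θ : ℝ) :
    ∀ᵐ w ∂jmeas, ContDiffAt ℝ 4 (fun ϑ : ℝ => f (polarAngle (centredRep (WithLp.ofLp (γ ϑ - jshift w)))) - m) θ :=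
  (ae_jmeas_offGrid (γ θ)).mono fun w hw => contDiffAt_angularFactor_comp_curve_sub hf hper m hγ (jshift w) hw.1 hw.2

end AE

/-! ## §2b The whole-square a.e. form with INTEGRABLE (not necessarily continuous) majorants — step-function enclosures of a certificate qualify -/

section Integrable

variable (d : ℕ) {F : (Fin 2 → ℝ) → ℝ} {χ A : EuclideanSpace ℝ (Fin 2) → ℝ} {m : ℝ} {γ : ℝ → EuclideanSpace ℝ (Fin 2)}

/-- **Mixed-moment form, whole square, a.e. hypotheses, integrable majorants**: as `abs_iteratedDeriv_jhigh1_comp_curve_le_mixedMoments_ae` but the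
majorants `cdef i`, `adef j`, `tdef` need only make `J̃J̃·cdef i·adef (k−i)` and `J̃J̃·tdef` integrable on the smoothing square (cellwise-constant
certificate enclosures are fine). -/
theorem abs_iteratedDeriv_jhigh1_comp_curve_le_mixedMoments_ae_of_integrable (hF : Continuous F)
    (hG : ContDiff ℝ 4 (fun q : EuclideanSpace ℝ (Fin 2) => F (WithLp.ofLp q))) (hγ : ContDiff ℝ 4 γ) {k : ℕ} (hk : k ≤ 4) (θ : ℝ)
    (hGdec : ∀ q, F (WithLp.ofLp q) = m + χ q * A q) (hflat : ∀ ϑ : ℝ, χ (γ ϑ) = 1) (hχ : ContDiff ℝ 4 χ)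
    {cdef adef : ℕ → ℝ × ℝ → ℝ} {tdef : ℝ × ℝ → ℝ}
    (hMint : ∀ i ≤ k, Integrable (fun w => jweight d w * (cdef i w * adef (k - i) w)) jmeas)
    (hTint : Integrable (fun w => jweight d w * tdef w) jmeas)
    (hw : ∀ᵐ w ∂jmeas, ContDiffAt ℝ 4 (fun ϑ : ℝ => A (γ ϑ - jshift w)) θ ∧
      (∀ i ≤ k, |iteratedDeriv i (fun ϑ : ℝ => χ (γ ϑ - jshift w) - 1) θ| ≤ cdef i w) ∧
      (∀ j ≤ k, |iteratedDeriv j (fun ϑ : ℝ => A (γ ϑ - jshift w)) θ| ≤ adef j w) ∧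
      |iteratedDeriv k (fun ϑ : ℝ => A (γ ϑ - jshift w)) θ - iteratedDeriv k (fun ϑ : ℝ => A (γ ϑ)) θ| ≤ tdef w)
    {Mx : ℕ → ℝ} (hMx : ∀ i ≤ k, ∫ w, jweight d w * (cdef i w * adef (k - i) w) ∂jmeas ≤ Mx i)
    {Tm : ℝ} (hTm : ∫ w, jweight d w * tdef w ∂jmeas ≤ Tm) :
    |iteratedDeriv k ((fun q : EuclideanSpace ℝ (Fin 2) => jhigh1 d F (WithLp.ofLp q)) ∘ γ) θ| ≤
      (∑ i ∈ Finset.range (k + 1), (k.choose i : ℝ) * Mx i) + Tm := by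
  set P : ℝ × ℝ → ℝ := fun w => (∑ i ∈ Finset.range (k + 1), (k.choose i : ℝ) * cdef i w * adef (k - i) w) + tdef w with hP
  have eP : (fun w => jweight d w * P w) =
      fun w => (∑ i ∈ Finset.range (k + 1), (k.choose i : ℝ) * (jweight d w * (cdef i w * adef (k - i) w))) + jweight d w * tdef w := by
    funext w; simp only [hP, mul_add, Finset.mul_sum]; congr 1; refine Finset.sum_congr rfl fun i _ => ?_; ring
  have ii : ∀ i ∈ Finset.range (k + 1), Integrable (fun w => (k.choose i : ℝ) * (jweight d w * (cdef i w * adef (k - i) w))) jmeas := by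
    intro i hi
    exact (hMint i (Nat.lt_succ_iff.mp (Finset.mem_range.mp hi))).const_mul _
  have iS1 : Integrable (fun w => ∑ i ∈ Finset.range (k + 1), (k.choose i : ℝ) * (jweight d w * (cdef i w * adef (k - i) w))) jmeas :=
    integrable_finsetSum _ ii
  have iP : Integrable (fun w : ℝ × ℝ => jweight d w * P w) jmeas := by rw [eP]; exact iS1.add hTint
  have hM : ∀ᵐ w ∂jmeas,
      |iteratedDeriv k (fun ϑ : ℝ => F (WithLp.ofLp (γ ϑ - jshift w))) θ - iteratedDeriv k (fun ϑ : ℝ => F (WithLp.ofLp (γ ϑ))) θ| ≤ P w := by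
    refine hw.mono fun w hw => ?_
    obtain ⟨hAv, hc, ha, ht⟩ := hw
    have hcv : ContDiff ℝ 4 (fun ϑ : ℝ => χ (γ ϑ - jshift w)) := hχ.comp (hγ.sub contDiff_const)
    exact abs_iteratedDeriv_displacedDiff_le_structured_of_contDiffAt (G := fun q : EuclideanSpace ℝ (Fin 2) => F (WithLp.ofLp q)) hGdec hflat hcv
      hAv hk (c := fun i => cdef i w) (a := fun j => adef j w) hc ha ht
  refine (abs_iteratedDeriv_jhigh1_comp_curve_le_integral_ae d hF hG hγ hk θ iP hM).trans ?_
  rw [eP, integral_add iS1 hTint, integral_finsetSum _ ii]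
  refine add_le_add (Finset.sum_le_sum fun i hi => ?_) hTm
  have hik : i ≤ k := Nat.lt_succ_iff.mp (Finset.mem_range.mp hi)
  rw [integral_const_mul]
  exact mul_le_mul_of_nonneg_left (hMx i hik) (by positivity)

end Integrable

/-! ## §3 The whole-square flow instance with no smoothness hypothesis on the angular factor -/

section FlowAE

variable {L M : ℕ} [NeZero L] [NeZero M]

/-- **THE (C1) DOOR v2 AT THE FLOW PIECE — WHOLE SQUARE, A.E. MAJORANTS, BUNDLE'S OWN ANGULAR FACTOR.**  With `f = ν_n(K_n)` (`C⁴`, `hon`),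
`γ = toLp ∘ k_F^{K′}` (`C⁴`, inside the flat tube: `hflat`), `χ = klFlatCutoffFn μ`, `A = (f − mean f)∘polarAngle∘centredRep` and `d = klFlowDeg n`:
if majorants `cdef i w ≥ |∂ⁱ[χ∘(γ−v_w) − 1](θ)|`, `adef j w ≥ |∂ʲ[A∘(γ−v_w)](θ)|`, `tdef w ≥ |∂ᵏ[A∘(γ−v_w)](θ) − ∂ᵏ[A∘γ](θ)|` hold for a.e. `w`
in the smoothing square (integrable against `J̃J̃`; cellwise-constant certificate enclosures qualify), with mixed moments `∫J̃J̃·cdef i·adef (k−i) ≤ Mx i` and `∫J̃J̃·tdef ≤ Tm`, then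
`|∂ᵏ[ν_n(K_n) − (klFlowPiece n).eval∘k_F^{K′}](θ)| ≤ Σ_{i≤k} C(k,i)·Mx i + Tm` (`k ≤ 4`) — the smoothness of `A` along a.e. displaced curve is automatic (§2). -/
theorem flowPiece_reading_remainder_jets_mixedMoments_ae (β U : ℝ) {μ : ℝ} (hμ : μ ∈ klWindowC) (n : ℕ) (K' : TrigPolyC4v)
    (hf : ContDiff ℝ 4 fun θ : ℝ => klLocalPart L M β U μ (klFlowFrameU L M β U μ n) n θ)
    (hon : ∀ θ, klFrameExtFn μ (fun θ => klLocalPart L M β U μ (klFlowFrameU L M β U μ n) n θ) (klFermiPoint μ K' θ) =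
      klLocalPart L M β U μ (klFlowFrameU L M β U μ n) n θ)
    (hγ : ContDiff ℝ 4 fun θ => (WithLp.toLp 2 (klFermiPoint μ K' θ) : EuclideanSpace ℝ (Fin 2)))
    (hflat : ∀ ϑ : ℝ, klFlatCutoffFn μ (klFermiPoint μ K' ϑ) = 1)
    {k : ℕ} (hk : k ≤ 4) (θ : ℝ)
    {cdef adef : ℕ → ℝ × ℝ → ℝ} {tdef : ℝ × ℝ → ℝ}
    (hMint : ∀ i ≤ k, Integrable (fun w => jweight (klFlowDeg n) w * (cdef i w * adef (k - i) w)) jmeas)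
    (hTint : Integrable (fun w => jweight (klFlowDeg n) w * tdef w) jmeas)
    (hw : ∀ᵐ w ∂jmeas,
      (∀ i ≤ k, |iteratedDeriv i (fun ϑ : ℝ =>
        klFlatCutoffFn μ (WithLp.ofLp ((WithLp.toLp 2 (klFermiPoint μ K' ϑ) : EuclideanSpace ℝ (Fin 2)) - jshift w)) - 1) θ| ≤ cdef i w) ∧
      (∀ j ≤ k, |iteratedDeriv j (fun ϑ : ℝ =>
        klLocalPart L M β U μ (klFlowFrameU L M β U μ n) n
            (polarAngle (centredRep (WithLp.ofLp ((WithLp.toLp 2 (klFermiPoint μ K' ϑ) : EuclideanSpace ℝ (Fin 2)) - jshift w)))) -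
          klAngularMean (fun θ => klLocalPart L M β U μ (klFlowFrameU L M β U μ n) n θ)) θ| ≤ adef j w) ∧
      |iteratedDeriv k (fun ϑ : ℝ =>
          klLocalPart L M β U μ (klFlowFrameU L M β U μ n) n
              (polarAngle (centredRep (WithLp.ofLp ((WithLp.toLp 2 (klFermiPoint μ K' ϑ) : EuclideanSpace ℝ (Fin 2)) - jshift w)))) -
            klAngularMean (fun θ => klLocalPart L M β U μ (klFlowFrameU L M β U μ n) n θ)) θ -
        iteratedDeriv k (fun ϑ : ℝ =>
          klLocalPart L M β U μ (klFlowFrameU L M β U μ n) n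
              (polarAngle (centredRep (WithLp.ofLp (WithLp.toLp 2 (klFermiPoint μ K' ϑ) : EuclideanSpace ℝ (Fin 2))))) -
            klAngularMean (fun θ => klLocalPart L M β U μ (klFlowFrameU L M β U μ n) n θ)) θ| ≤ tdef w)
    {Mx : ℕ → ℝ} (hMx : ∀ i ≤ k, ∫ w, jweight (klFlowDeg n) w * (cdef i w * adef (k - i) w) ∂jmeas ≤ Mx i)
    {Tm : ℝ} (hTm : ∫ w, jweight (klFlowDeg n) w * tdef w ∂jmeas ≤ Tm) :
    |iteratedDeriv k (fun θ => klLocalPart L M β U μ (klFlowFrameU L M β U μ n) n θ -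
        (klFlowPiece L M β U μ n).eval (klFermiPoint μ K' θ)) θ| ≤
      (∑ i ∈ Finset.range (k + 1), (k.choose i : ℝ) * Mx i) + Tm := by
  set f : ℝ → ℝ := fun θ => klLocalPart L M β U μ (klFlowFrameU L M β U μ n) n θ with hfdef
  set F : (Fin 2 → ℝ) → ℝ := klFrameExtFn μ f with hFdef
  set γ : ℝ → EuclideanSpace ℝ (Fin 2) := fun θ => WithLp.toLp 2 (klFermiPoint μ K' θ) with hγdef
  set A : EuclideanSpace ℝ (Fin 2) → ℝ := fun q => f (polarAngle (centredRep (WithLp.ofLp q))) - klAngularMean f with hAdef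
  have hper : Function.Periodic f (2 * Real.pi) := klLocalPart_periodic β U μ _ n
  have hG : ContDiff ℝ 4 (fun q : EuclideanSpace ℝ (Fin 2) => F (WithLp.ofLp q)) := contDiff_onM_klFrameExtFn (N := 4) hf hper hμ
  have hFc : Continuous F := continuous_klFrameExtFn_of_contDiff hG
  have hχ : ContDiff ℝ 4 (fun q : EuclideanSpace ℝ (Fin 2) => klFlatCutoffFn μ (WithLp.ofLp q)) := contDiff_klFlatCutoffFn_ofLp μ
  have hflat' : ∀ ϑ : ℝ, (fun q : EuclideanSpace ℝ (Fin 2) => klFlatCutoffFn μ (WithLp.ofLp q)) (γ ϑ) = 1 := fun ϑ => by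
    simp only [hγdef, WithLp.ofLp_toLp]; exact hflat ϑ
  have hGdec : ∀ q : EuclideanSpace ℝ (Fin 2), F (WithLp.ofLp q) =
      klAngularMean f + (fun q : EuclideanSpace ℝ (Fin 2) => klFlatCutoffFn μ (WithLp.ofLp q)) q * A q := fun q =>
    klFrameExtFn_ofLp_eq_mean_add_cutoff_mul μ f q
  have hsm := ae_jmeas_contDiffAt_angularFactor_comp_curve_sub hf hper (klAngularMean f) hγ θ
  have hw' : ∀ᵐ w ∂jmeas, ContDiffAt ℝ 4 (fun ϑ : ℝ => A (γ ϑ - jshift w)) θ ∧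
      (∀ i ≤ k, |iteratedDeriv i (fun ϑ : ℝ => (fun q : EuclideanSpace ℝ (Fin 2) => klFlatCutoffFn μ (WithLp.ofLp q)) (γ ϑ - jshift w) - 1) θ| ≤
        cdef i w) ∧
      (∀ j ≤ k, |iteratedDeriv j (fun ϑ : ℝ => A (γ ϑ - jshift w)) θ| ≤ adef j w) ∧
      |iteratedDeriv k (fun ϑ : ℝ => A (γ ϑ - jshift w)) θ - iteratedDeriv k (fun ϑ : ℝ => A (γ ϑ)) θ| ≤ tdef w := by
    filter_upwards [hsm, hw] with w h1 h2
    exact ⟨h1, h2.1, h2.2.1, h2.2.2⟩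
  rw [jacksonObject_eq_jhigh1_comp_curve (L := L) (M := M) β U hμ n K' hf hon]
  exact abs_iteratedDeriv_jhigh1_comp_curve_le_mixedMoments_ae_of_integrable (klFlowDeg n) hFc hG hγ hk θ hGdec hflat' hχ hMint hTint
    hw' hMx hTm

end FlowAE

end Summit.HubbardSuperconductivity.HubbardSuperconductivity.Theorems.KLRegimeSplit

end
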